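import Summits.AtomisticToContinuum.HydrodynamicLimit.Theses.ExpTailStaging

/-!
# Birth skeleton of the crux `ExpVelocityMomentBound` (stmt-AtomisticToContinuum-11518)

Route `route-AtomisticToContinuum-ExpTailStaging`, crux decl
`Summit.AtomisticToContinuum.HydrodynamicLimit.Theses.ExpTailStaging.ExpVelocityMomentBound` (K1 of the card
yau-exponent-forced-divergence-squeeze-v2): ONE exponential velocity-moment rate along the DETERMINISTIC
hard-sphere flow from local Gibbs data, uniformly in `N`:
`∀ profiles ∃ σ₀ ∀ σ < σ₀ ∀ T > 0 ∀ Φ ∃ κ > 0 ∃ C N₀ ∀ N ≥ N₀ ∀ t ∈ [0,T],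
E_{λ_N}[(N+1)⁻¹ Σᵢ exp(κ‖vᵢ(Φ_N(t) z)‖)] ≤ C`.
Skeleton registrar `planner-skel-stmt-AtomisticToContinuum-11518-0`, 2026-08-17 (BC3 birth certificate of
the crux; route re-audit bin REPAIRABLE). The crux is kept VERBATIM (its `∀ T > 0` prefix included; the
refuters' pre-shock repair `ExpVelocityMomentBoundPreShock`, evidence `Cprime.lean` / `Repair11518.lean` on
the item, is the planner's restatement business, not this skeleton's — the same three stubs serve it with the
Euler/LLN guard added to S2 only).

The three stubs are the three moves of the standard architecture of exponential-moment theorems in kinetic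
theory (creation/propagation of moments: BobylevGambaPanferov2004, GambaPanferovVillani2009, AlonsoEtAl2013
Thm 2; N-particle: MischlerMouhot2012) transplanted to the deterministic `N`-sphere flow at fixed reduced
density, with the dynamical step put in its LARGE-DEVIATION (tail) form:

* `stub_initialExpMoments` (S1, STATICS, size M, provable now): under the local Gibbs law the velocities are,
  conditionally on the positions, independent Gaussians `N(u₀(xᵢ), θ₀(xᵢ)𝟙)`, so for EVERY rate `κ > 0`
  `E_{λ_N}[(N+1)⁻¹ Σᵢ e^{κ‖vᵢ‖}] ≤ e^{κ‖u₀‖_∞} E e^{κ√θ_max |ξ|} =: C₀(κ)` uniformly in `N` and in the flow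
  (the "true at `t = 0`" clause of the crux docstring, as a lemma; `λ_N` is a probability measure or `0`).
* `stub_taggedSpeedExpTail` (S2, THE HEART, open-problem size): GIVEN all initial exponential moments (S1's
  conclusion at the same `σ`), along the deterministic flow every tagged sphere keeps an exponential SPEED TAIL
  with ONE rate, uniformly in `N ≥ N₀` and `t ≤ T`:
  `λ_N{‖vᵢ(Φ_N(t)z)‖ > V} ≤ C e^{-κV}` for all `i`, `V ≥ 0`. This is the form a dynamical argument estimates
  (probability of an energy-focusing collision history delivering kinetic energy `V²/2` to one sphere) and
  the form of the route's own kill criterion ("a pre-shock witness with `P(|v₁(t)| > V) ≥ e^{-o(V)}`").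
  It cannot come from entropy / invariant-measure comparison (`EntropyBlindToCubicMoments`: relative entropy
  `O(N)` w.r.t. the invariant Gibbs law controls empirical moments of order ≤ 2 only) — it is the dynamical input.
* `stub_tailsToExpMoment` (S3, MEASURE THEORY, size S–M, provable now): exponential speed tails of every sphere
  at time `t` under a probability law give the averaged exponential moment at HALF the rate with constant
  `C + 1` (layer cake: `E e^{aX} = 1 + ∫₀^∞ a e^{aV} P(X > V) dV ≤ 1 + aC/(κ − a)`, `a = κ/2`).
* Composition `ExpVelocityMomentBound_of : S1 → S2 → S3 → ExpVelocityMomentBound` (sorry-free; real content: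
  the density threshold `min σ₁ (min σ₂ σ₃)` with `σ₃` from the LANDED statics `LocalGibbsConcentration_holds`
  (local Gibbs laws are probability measures), feeding S1 into S2, halving the rate and `C ↦ C + 1` through S3
  at each `(N, t)`), and `ExpVelocityMomentBound_skeleton` = the crux modulo the three sorries.

Disproof used: none exists for this crux at registration (`ledger crux ls stmt-AtomisticToContinuum-11518`: no
workfiles). Evidence honoured: hotspot.md (planner, 2026-08-15) — a spatially AVERAGED Povzner hierarchy cannot
deliver K1; accordingly no stub here is a Povzner moment inequality: S2 is stated per tagged sphere in tail form
and leaves the gain reference to the prover. Negatives index: no refuted statement of the summit is an instance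
of S1–S3 (no Euler-quantified item without the `t = 0` tie occurs: S1/S3 are statics / measure theory, S2 is
keyed on the local Gibbs law at time 0 exactly as the crux).
-/

noncomputable section

open MeasureTheory Filter Set
open scoped ENNReal Topology

namespace Summit.AtomisticToContinuum.HydrodynamicLimit.Cruxes.ExpVelocityMomentBound.Birth

open Literature.MathematicalPhysics.KineticTheory Literature.Analysis.FluidPDE
open Summit.AtomisticToContinuum.HydrodynamicLimit.Theses

/-! ## §0 Objects of the line -/

/-- **All exponential velocity moments at time zero, uniformly in `N`** (the statics currency of the line):
for every rate `κ > 0` there is `C₀` with `E_{λ_N}[(N+1)⁻¹ Σᵢ exp(κ‖vᵢ‖)] ≤ C₀` for every `N` and every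
flow (the flow only fixes the phase space of `localGibbsLaw`). -/
def InitialExpMoments (σ : ℝ) (a₀ : T3 → ℝ) (u₀ : T3 → V3) (θ₀ : T3 → ℝ) : Prop :=
  ∀ κ : ℝ, 0 < κ → ∃ C₀ : ℝ,
    ∀ (N : ℕ) (Φ : HardSphereFlow (Literature.Analysis.FluidPDE.Torus.geometry (Fin 3)) (hsDiameter σ N) (N + 1)),
      ∫⁻ z, ENNReal.ofReal (((N : ℝ) + 1)⁻¹ * ∑ i : Fin (N + 1), Real.exp (κ * ‖(z i).2‖))
        ∂(localGibbsLaw σ a₀ u₀ θ₀ N Φ) ≤ ENNReal.ofReal C₀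

/-- **Exponential speed tail of every tagged sphere at time `t`** (one `N`, one flow; the dynamical currency
of the line): `λ_N{z | V < ‖vᵢ(Φ_t z)‖} ≤ C e^{-κV}` for every particle `i` and every level `V ≥ 0`. -/
def SpeedTailAt (σ : ℝ) (a₀ : T3 → ℝ) (u₀ : T3 → V3) (θ₀ : T3 → ℝ) (N : ℕ)
    (Φ : HardSphereFlow (Literature.Analysis.FluidPDE.Torus.geometry (Fin 3)) (hsDiameter σ N) (N + 1))
    (t κ C : ℝ) : Prop :=
  ∀ (i : Fin (N + 1)) (V : ℝ), 0 ≤ V →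
    localGibbsLaw σ a₀ u₀ θ₀ N Φ {z | V < ‖(Φ.flow t z i).2‖} ≤ ENNReal.ofReal (C * Real.exp (-(κ * V)))

/-! ## §1 Stub signatures

Each stub's statement is the `Prop` `Sig.stub_<name>`; the registered obligation is
`theorem stub_<name> : Sig.stub_<name> := by sorry` (§2); the composition `ExpVelocityMomentBound_of` takes the
three signatures as hypotheses BY NAME. -/

/-- **S1 — initial exponential moments (statics; size M, provable now).** For continuous profiles
`a₀, θ₀ > 0`, `u₀` there is `σ₀ > 0` such that for `0 < σ < σ₀` the local Gibbs laws have ALL exponential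
velocity moments, uniformly in `N`: `InitialExpMoments σ a₀ u₀ θ₀`. Why plausibly true: `canonicalDensity`
restricts the product `∏ᵢ a₀(xᵢ) M_{1,u₀(xᵢ),θ₀(xᵢ)}(vᵢ)` to the hard-sphere domain, a constraint on POSITIONS
only, so given the positions the velocities are independent Gaussians with temperature `≤ θ_max` and drift
`≤ ‖u₀‖_∞` (continuous profiles on the compact torus): `E[e^{κ‖vᵢ‖} | x] ≤ e^{κ‖u₀‖_∞}(2e^{κ²θ_max/2})³`; the law is a
probability measure for `σ ≤ 1/2` (`isProbabilityMeasure_localGibbsLaw`) and the zero measure on the junk branch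
`𝒵 = 0`. Leans on (all in `Literature.MathematicalPhysics.KineticTheory.HardSphereEulerProofs`, imported here through the
route file): `localGibbsLaw_eq` (flow-free `localGibbsMeasure`), the disintegration `lintegral_localGibbsMeasure`
(position weight × `velMeasure u₀ θ₀ x = ⊗ᵢ gaussMeasure (u₀ (x i)) (θ₀ (x i))`), `gaussMeasure_eq_map_map`,
`isProbabilityMeasure_localGibbsLaw`; one-body exponential moment of a Gaussian:
`Literature.Probability.Moments.GaussianNormExpMoment.integrable_exp_mul_norm_of_isGaussian`,
`lintegral_exp_mul_centred_gaussMeasure_le` (HardSphereWindowPressureStatic). -/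
def Sig.stub_initialExpMoments : Prop :=
  ∀ (a₀ θ₀ : T3 → ℝ) (u₀ : T3 → V3), Continuous a₀ → Continuous θ₀ → Continuous u₀ →
    (∀ x, 0 < a₀ x) → (∀ x, 0 < θ₀ x) →
    ∃ σ₀ : ℝ, 0 < σ₀ ∧ ∀ σ : ℝ, 0 < σ → σ < σ₀ → InitialExpMoments σ a₀ u₀ θ₀

/-- **S2 — one exponential speed-tail rate for every tagged sphere along the deterministic flow (THE HEART;
open-problem size).** For continuous profiles there is `σ₀ > 0` such that for `0 < σ < σ₀`, IF the local Gibbs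
laws have all exponential velocity moments uniformly in `N` (S1's conclusion), THEN for every horizon `T > 0`
and every flow family there are ONE rate `κ > 0`, `C ≥ 0` and `N₀` with
`λ_N{‖vᵢ(Φ_N(t)z)‖ > V} ≤ C e^{-κV}` for all `N ≥ N₀`, `t ∈ [0,T]`, `i`, `V ≥ 0`. Why plausibly true: kinetic
energy is conserved and additive, so a sphere of speed `V ≫ √θ` must have harvested `≍ V²` thermal energies
through a focusing collision history whose local-Gibbs probability should be exponentially small in (at
least) `V`; Boltzmann-level analogues CREATE rate-`1` exponential moments (AlonsoEtAl2013 Thm 1). Why it might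
fail = the crux's why-line verbatim (N-uniformity; rattler cages; a sub-exponential-cost focusing tree gives
`P(‖v₁(t)‖ > V) ≥ e^{-o(V)}`), plus the refuters' `∀ T` flag (no Euler tie: post-shock implosion profiles).
Leans on: `HardSphereFlow` (`isTrajectory`, `measurePreserving`, `flow_add`), `localGibbsLaw`, `InitialExpMoments`;
natural tools from the sibling crux chain of `EnergyCurrentTails` (stmt-9235, the cubic shadow of K1 via the route's
`ExpRateGivesCubicUI`): the deterministic Povzner ledger `IsHardSphereTrajectory.sub_eq_integral_add_collisionalTransfer`,
the Loschmidt-tagging lemmas of `Theorems.LoschmidtTagging`, and its `EquilibriumRung.lean` pattern (constant profiles: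
the law is flow-invariant, so S2 holds there with the time-zero Gaussian tail — the special case in kind).
Disproof knowledge honoured (9235 `Disproof.lean`, landed `Theorems/EnergyCurrentTails/Negative/*`): the SURE version
over bounded-energy configurations is false (`energyCurrentTails_false_without_randomness`, one sphere at speed
`√(N+1)`) — S2 keeps the randomness of the data; quadratic UI alone does not give higher tails
(`energyCurrentTails_false_of_quadraticUI_only`) — S2 is keyed on the full local Gibbs law, not on energy;
focusing trees exist kinematically (`focusing_tree`) — S2 asks exactly for their Liouville weight. -/
def Sig.stub_taggedSpeedExpTail : Prop :=
  ∀ (a₀ θ₀ : T3 → ℝ) (u₀ : T3 → V3), Continuous a₀ → Continuous θ₀ → Continuous u₀ →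
    (∀ x, 0 < a₀ x) → (∀ x, 0 < θ₀ x) →
    ∃ σ₀ : ℝ, 0 < σ₀ ∧ ∀ σ : ℝ, 0 < σ → σ < σ₀ → InitialExpMoments σ a₀ u₀ θ₀ →
      ∀ T : ℝ, 0 < T →
        ∀ Φ : (N : ℕ) → HardSphereFlow (Literature.Analysis.FluidPDE.Torus.geometry (Fin 3)) (hsDiameter σ N) (N + 1),
          ∃ κ : ℝ, 0 < κ ∧ ∃ C : ℝ, 0 ≤ C ∧ ∃ N₀ : ℕ, ∀ N : ℕ, N₀ ≤ N → ∀ t ∈ Set.Icc 0 T,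
            SpeedTailAt σ a₀ u₀ θ₀ N (Φ N) t κ C

/-- **S3 — exponential tails give the exponential moment at half the rate (measure theory; size S–M,
provable now).** For one `N`, one flow, one time `t`: if the local Gibbs law is a probability measure and every
tagged sphere has the speed tail `≤ C e^{-κV}` (`V ≥ 0`, `C ≥ 0`, `κ > 0`), then
`E[(N+1)⁻¹ Σᵢ exp(κ/2 ‖vᵢ(Φ_t z)‖)] ≤ C + 1`. Why true: per particle `e^{aX} = 1 + ∫₀^∞ a e^{aV} 𝟙{V < X} dV`
(`X = ‖vᵢ‖ ≥ 0`), Tonelli, `∫₀^∞ a e^{aV} C e^{-κV} dV = aC/(κ−a) = C` at `a = κ/2`; average over `i`.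
Leans on: Mathlib layer-cake (`MeasureTheory.lintegral_eq_lintegral_meas_lt` /
`lintegral_comp_eq_lintegral_meas_lt_mul`), `HardSphereFlow.measurable_flow` (measurability of
`z ↦ ‖(Φ.flow t z i).2‖`), `integral_exp_neg_mul`-type evaluations. -/
def Sig.stub_tailsToExpMoment : Prop :=
  ∀ (σ : ℝ) (a₀ θ₀ : T3 → ℝ) (u₀ : T3 → V3) (N : ℕ)
    (Φ : HardSphereFlow (Literature.Analysis.FluidPDE.Torus.geometry (Fin 3)) (hsDiameter σ N) (N + 1))
    (t κ C : ℝ), 0 < κ → 0 ≤ C → IsProbabilityMeasure (localGibbsLaw σ a₀ u₀ θ₀ N Φ) →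
      SpeedTailAt σ a₀ u₀ θ₀ N Φ t κ C →
        ∫⁻ z, ENNReal.ofReal (((N : ℝ) + 1)⁻¹ * ∑ i : Fin (N + 1), Real.exp (κ / 2 * ‖(Φ.flow t z i).2‖))
          ∂(localGibbsLaw σ a₀ u₀ θ₀ N Φ) ≤ ENNReal.ofReal (C + 1)

/-! ## §2 Stubs (registered; `sorry` only inside them) — hardest: `stub_taggedSpeedExpTail` -/

/-- **S1 (M, provable now).** All exponential velocity moments of the local Gibbs laws, uniformly in `N`. -/
theorem stub_initialExpMoments : Sig.stub_initialExpMoments := by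
  sorry

/-- **S2 (open; the heart).** One exponential speed-tail rate for every tagged sphere along the flow. -/
theorem stub_taggedSpeedExpTail : Sig.stub_taggedSpeedExpTail := by
  sorry

/-- **S3 (S–M, provable now).** Exponential speed tails ⇒ exponential moment at half the rate. -/
theorem stub_tailsToExpMoment : Sig.stub_tailsToExpMoment := by
  sorry

/-! ## §3 Composition (sorry-free) -/

/-- **The line closes the crux modulo its stubs**: `ExpVelocityMomentBound` BY NAME from S1, S2, S3. Real
content: the common density threshold `min σ₁ (min σ₂ σ₃)` — `σ₃` from the landed statics
`ExpTailStaging.LocalGibbsConcentration_holds` (local Gibbs laws are probability measures) — S1 fed into S2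
at the same `σ`, then at each `(N, t)` the tails of S2 turned into the moment at rate `κ/2` with constant
`C + 1` by S3. -/
theorem ExpVelocityMomentBound_of (h₁ : Sig.stub_initialExpMoments) (h₂ : Sig.stub_taggedSpeedExpTail)
    (h₃ : Sig.stub_tailsToExpMoment) : ExpTailStaging.ExpVelocityMomentBound := by
  intro a₀ θ₀ u₀ ha hθ hu hap hθp
  obtain ⟨σ₁, hσ₁, G₁⟩ := h₁ a₀ θ₀ u₀ ha hθ hu hap hθp
  obtain ⟨σ₂, hσ₂, G₂⟩ := h₂ a₀ θ₀ u₀ ha hθ hu hap hθp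
  obtain ⟨σ₃, hσ₃, G₃⟩ := ExpTailStaging.LocalGibbsConcentration_holds a₀ θ₀ u₀ ha hθ hu hap hθp
  refine ⟨min σ₁ (min σ₂ σ₃), lt_min hσ₁ (lt_min hσ₂ hσ₃), ?_⟩
  intro σ hσ hσlt T hT Φ
  have hσ₁' : σ < σ₁ := lt_of_lt_of_le hσlt (min_le_left _ _)
  have hσ₂' : σ < σ₂ := lt_of_lt_of_le hσlt ((min_le_right _ _).trans (min_le_left _ _))
  have hσ₃' : σ < σ₃ := lt_of_lt_of_le hσlt ((min_le_right _ _).trans (min_le_right _ _))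
  have hinit : InitialExpMoments σ a₀ u₀ θ₀ := G₁ σ hσ hσ₁'
  obtain ⟨κ, hκ, C, hC, N₀, H⟩ := G₂ σ hσ hσ₂' hinit T hT Φ
  obtain ⟨ρ₀, -, -, hprob, -⟩ := G₃ σ hσ hσ₃'
  refine ⟨κ / 2, half_pos hκ, C + 1, N₀, fun N hN t ht => ?_⟩
  exact h₃ σ a₀ θ₀ u₀ N (Φ N) t κ C hκ hC (hprob N (Φ N)) (H N hN t ht)

/-- The skeleton instantiated: the crux modulo the three registered stubs. -/
theorem ExpVelocityMomentBound_skeleton : ExpTailStaging.ExpVelocityMomentBound :=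
  ExpVelocityMomentBound_of stub_initialExpMoments stub_taggedSpeedExpTail stub_tailsToExpMoment

end Summit.AtomisticToContinuum.HydrodynamicLimit.Cruxes.ExpVelocityMomentBound.Birth

end
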